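import Summits.CriticalPhenomena.PercolationContinuityZ3.Theorems.PercBoundarySqueezeFreeBoxFatClusterMassJumpSplit
import Summits.CriticalPhenomena.PercolationContinuityZ3.Theses.PercFiniteBoxLRO
import Literature.Probability.Percolation.PercolationProofs
import Literature.Probability.Percolation.UniquenessZone

/-!
# Crux `PercBoundarySqueeze.FreeBoxFatClusterMass` (stmt-CriticalPhenomena-6982): the registered stub B_∞ is
# summit-strength modulo linear-scale box long-range order (`PercFiniteBoxLRO.LinearScaleLROOfTheta`)

Helper file of the lead prover's line `registered` (skeleton v2), landed `--supports stmt-CriticalPhenomena-6982`;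
sorry-free.  B_∞ = `stub_giantFatMass` = "at `p_c(ℤ³)` the fat in-box pieces (`≥ ⌊R^{3/2}⌋` vertices joined inside
`Λ_R`) OF THE INFINITE CLUSTER carry `≤ C R^{3-δ}` expected mass".  It is vacuous when `θ(p_c) = 0`
(`giantFatMass_of_continuity`).  Here we show the converse modulo Cerf's "missing ingredient"
`LinearScaleLROOfTheta` (stmt-CriticalPhenomena-0855: `θ(p) > 0 ⟹ ∃ ρ > 0, K: P_p(x ↔ y in Λ_{Kn}) ≥ ρ` for all
`x, y ∈ Λ_n`):

* `percolationContinuityZ3_of_linearScaleLRO_of_giantFatMass` : **0855 → B_∞ → θ(p_c) = 0.**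

So, granted 0855, B_∞ ⟺ `PercolationContinuityZ3` (compare `percolationContinuityZ3_of_linearScaleLRO_of_jump`,
which needed B_∞ AND the finite-cluster tail A; here A is replaced by the qualitative `P(R ≤ |C(0)| < ∞) → 0`).
Proof: if `θ(p_c) > 0`, 0855 gives `ρ, K`; for `x ∈ Λ_n`, `R = Kn`, reverse Markov (`GiantLRO.sum_real_le`) with
`t = ρ|Λ_n|/2 ≥ ⌊R^{3/2}⌋` gives `P(fat_R(x)) ≥ ρ/2`, the jump split and `GiantLRO.finiteTail_eventually_le`
(continuity from above along "`C(0)` finite and `0 ↔ ∂Λ_k` for all `k ≤ r`", null intersection) give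
`P(fat_R(x) ∧ |C(x)| = ∞) ≥ ρ/4`; summing over `x ∈ Λ_n ⊆ Λ_R`: `(ρ/4)(2n+1)³ ≤ C_B (Kn)^{3-δ}`, false for large `n`.
-/

noncomputable section

namespace Summit.CriticalPhenomena.PercolationContinuityZ3.FreeBoxFatClusterMassLine

open MeasureTheory Filter Topology
open Literature.Probability.Percolation Literature.Probability.LatticeModels
open scoped Classical BigOperators ENNReal

namespace GiantLRO

/-! ### Reverse Markov for the number of in-box partners -/

/-- **Reverse Markov** (every `p`, `t ≥ 0`): for `x` and boxes `Λ_n`, `Λ_R`,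
`Σ_{y ∈ Λ_n} P(x ↔ y in Λ_R) ≤ t + |Λ_n| · P(t ≤ #{y ∈ Λ_n : x ↔ y in Λ_R})`
(pointwise `M ≤ t + |Λ_n| 1{M ≥ t}` for `M = #{y ∈ Λ_n : x ↔ y in Λ_R} ≤ |Λ_n|`, then integrate). -/
theorem sum_real_le (p : unitInterval) (n R : ℕ) (x : Site 3) {t : ℝ} (ht : 0 ≤ t) :
    ∑ y ∈ box 3 n, (bondPercolation (zdGraph 3) p).real (openConnIn (↑(box 3 R) : Set (Site 3)) x y) ≤
      t + ((box 3 n).card : ℝ) * (bondPercolation (zdGraph 3) p).real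
        {ω | t ≤ (((box 3 n).filter fun y => ω ∈ openConnIn (↑(box 3 R) : Set (Site 3)) x y).card : ℝ)} := by
  set μ := bondPercolation (zdGraph 3) p with hμ
  set E : Site 3 → Set (BondConfig (Site 3)) := fun y => openConnIn (↑(box 3 R) : Set (Site 3)) x y
    with hE
  set M : BondConfig (Site 3) → ℝ := fun ω => ∑ y ∈ box 3 n, (E y).indicator (1 : BondConfig (Site 3) → ℝ) ω
    with hM
  set G : Set (BondConfig (Site 3)) :=
    {ω | t ≤ (((box 3 n).filter fun y => ω ∈ openConnIn (↑(box 3 R) : Set (Site 3)) x y).card : ℝ)} with hG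
  have hEm : ∀ y, MeasurableSet (E y) := fun y => DCT16.measurableSet_openConnIn _ x y
  have hMm : Measurable M :=
    Finset.measurable_sum _ fun y _ => measurable_const.indicator (hEm y)
  -- `M ω` is the (real) cardinality of the filter
  have hMcard : ∀ ω, M ω =
      (((box 3 n).filter fun y => ω ∈ openConnIn (↑(box 3 R) : Set (Site 3)) x y).card : ℝ) := by
    intro ω
    rw [hM, Finset.natCast_card_filter]
    refine Finset.sum_congr rfl fun y _ => ?_
    simp only [Set.indicator_apply, Pi.one_apply, hE]
  have hGeq : G = {ω | t ≤ M ω} := by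
    ext ω; simp only [hG, Set.mem_setOf_eq, hMcard]
  have hGm : MeasurableSet G := by
    rw [hGeq]; exact measurableSet_le measurable_const hMm
  -- pointwise bound
  have hMle : ∀ ω, M ω ≤ ((box 3 n).card : ℝ) := by
    intro ω
    rw [hMcard]
    exact_mod_cast Finset.card_filter_le _ _
  have hpt : ∀ ω, M ω ≤ t + ((box 3 n).card : ℝ) * G.indicator (1 : BondConfig (Site 3) → ℝ) ω := by
    intro ω
    by_cases hω : ω ∈ G
    · rw [Set.indicator_of_mem hω, Pi.one_apply, mul_one]
      linarith [hMle ω]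
    · rw [Set.indicator_of_notMem hω, mul_zero, add_zero]
      have : ¬ t ≤ M ω := by rwa [hGeq] at hω
      exact (not_le.1 this).le
  -- integrate
  have hint1 : ∀ y, Integrable (fun ω => (E y).indicator (1 : BondConfig (Site 3) → ℝ) ω) μ := fun y =>
    (integrable_const (1 : ℝ)).indicator (hEm y)
  have hintM : Integrable M μ := integrable_finsetSum _ fun y _ => hint1 y
  have hintG : Integrable (fun ω => G.indicator (1 : BondConfig (Site 3) → ℝ) ω) μ :=
    (integrable_const (1 : ℝ)).indicator hGm
  have hintR : Integrable (fun ω => t + ((box 3 n).card : ℝ) * G.indicator (1 : BondConfig (Site 3) → ℝ) ω) μ :=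
    (integrable_const t).add (hintG.const_mul _)
  have hmono : ∫ ω, M ω ∂μ ≤ ∫ ω, (t + ((box 3 n).card : ℝ) * G.indicator (1 : BondConfig (Site 3) → ℝ) ω) ∂μ :=
    integral_mono hintM hintR hpt
  have hL : ∫ ω, M ω ∂μ = ∑ y ∈ box 3 n, μ.real (E y) := by
    rw [hM, integral_finsetSum _ fun y _ => hint1 y]
    exact Finset.sum_congr rfl fun y _ => integral_indicator_one (hEm y)
  have hR : ∫ ω, (t + ((box 3 n).card : ℝ) * G.indicator (1 : BondConfig (Site 3) → ℝ) ω) ∂μ =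
      t + ((box 3 n).card : ℝ) * μ.real G := by
    rw [integral_add (integrable_const t) (hintG.const_mul _), integral_const_mul, integral_const,
      integral_indicator_one hGm, smul_eq_mul, probReal_univ, one_mul]
  rw [hL, hR] at hmono
  exact hmono

/-- **Many in-box partners make a fat piece** (pointwise): if `⌊R^{3/2}⌋ ≤ t ≤ #{y ∈ Λ_n : x ↔ y in Λ_R}`
then some finset `T` with `Nat.sqrt (R^3) ≤ #T` is joined to `x` inside `Λ_R`. -/
theorem fat_of_count {n R : ℕ} {t : ℝ} (ht : ((Nat.sqrt (R ^ 3) : ℕ) : ℝ) ≤ t) {x : Site 3}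
    {ω : BondConfig (Site 3)}
    (h : t ≤ (((box 3 n).filter fun y => ω ∈ openConnIn (↑(box 3 R) : Set (Site 3)) x y).card : ℝ)) :
    ∃ T : Finset (Site 3), Nat.sqrt (R ^ 3) ≤ T.card ∧
      ∀ y ∈ T, ω ∈ openConnIn (↑(box 3 R) : Set (Site 3)) x y := by
  refine ⟨(box 3 n).filter fun y => ω ∈ openConnIn (↑(box 3 R) : Set (Site 3)) x y, ?_,
    fun y hy => (Finset.mem_filter.1 hy).2⟩
  exact_mod_cast ht.trans h

/-! ### The finite-cluster tail tends to zero (qualitative, every `p`) -/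

/-- The events along which we take the limit: `C(0)` finite and `0 ↔ ∂Λ_k` inside `Λ_k` for every
`k ≤ r`; antitone in `r` by construction. -/
def tailSet (r : ℕ) : Set (BondConfig (Site 3)) :=
  (percolatesAt (0 : Site 3))ᶜ ∩ ⋂ k ∈ Set.Iic r, toBdry k (0 : Site 3)

/-- `tailSet` is measurable. -/
theorem measurableSet_tailSet (r : ℕ) : MeasurableSet (tailSet r) :=
  (measurableSet_percolatesAt_holds (0 : Site 3)).compl.inter
    (MeasurableSet.biInter (Set.to_countable _) fun k _ => measurableSet_toBdry k 0)

/-- `tailSet` is antitone. -/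
theorem antitone_tailSet : Antitone tailSet := by
  intro r r' hrr' ω hω
  refine ⟨hω.1, ?_⟩
  have h2 := hω.2
  simp only [Set.mem_iInter] at h2 ⊢
  exact fun k hk => h2 k (le_trans (Set.mem_Iic.1 hk) hrr')

/-- The intersection of the `tailSet r` is contained in the null event `ω ⊄ E(ℤ³)`: on `ω ⊆ E(ℤ³)` a
finite cluster `C(0) ⊆ Λ_k` cannot reach `∂Λ_{k+1}` inside `Λ_{k+1}`. -/
theorem iInter_tailSet_subset :
    (⋂ r, tailSet r) ⊆ {ω : BondConfig (Site 3) | ¬ ω ⊆ (zdGraph 3).edgeSet} := by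
  intro ω hω hE
  simp only [Set.mem_iInter] at hω
  have hfin : (openCluster ω (0 : Site 3)).Finite := by
    have := (hω 0).1
    simpa [percolatesAt] using this
  obtain ⟨k, hk⟩ := DCT16.exists_subset_box hfin.toFinset
  have hb : ω ∈ toBdry (k + 1) (0 : Site 3) := by
    have := (hω (k + 1)).2
    simp only [Set.mem_iInter] at this
    exact this (k + 1) (Set.mem_Iic.2 le_rfl)
  obtain ⟨w, hw, hcw⟩ := hb
  have hwC : w ∈ openCluster ω (0 : Site 3) :=
    DCT16.reachable_of_pathIn (DCT16.pathIn_of_mem_openConnIn hcw)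
  have hwk : w ∈ box 3 k := hk (hfin.mem_toFinset.2 hwC)
  exact DCT16.notMem_box_of_mem_innerBoundary_box (Nat.lt_succ_self k) hw hwk

/-- On `ω ⊆ E(ℤ³)`: a finite cluster with more than `|Λ_r|` vertices reaches `∂Λ_k` inside `Λ_k` for
every `k ≤ r`, i.e. `ω ∈ tailSet r`. -/
theorem mem_tailSet_of_card {r : ℕ} {ω : BondConfig (Site 3)} (hE : ω ⊆ (zdGraph 3).edgeSet)
    (hfin : (openCluster ω (0 : Site 3)).Finite)
    (hbig : (box 3 r).card < (openCluster ω (0 : Site 3)).ncard) : ω ∈ tailSet r := by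
  refine ⟨by simpa [percolatesAt] using hfin, ?_⟩
  simp only [Set.mem_iInter]
  intro k hk
  have hk' : k ≤ r := Set.mem_Iic.1 hk
  -- the cluster is not inside `Λ_k`
  obtain ⟨z, hz, hzk⟩ : ∃ z ∈ openCluster ω (0 : Site 3), z ∉ box 3 k := by
    by_contra hcon
    push Not at hcon
    have hsub : openCluster ω (0 : Site 3) ⊆ ↑(box 3 k) := fun z hz => Finset.mem_coe.2 (hcon z hz)
    have h1 : (openCluster ω (0 : Site 3)).ncard ≤ (box 3 k).card := by
      simpa using Set.ncard_le_ncard hsub (Finset.finite_toSet _)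
    have h2 : (box 3 k).card ≤ (box 3 r).card := Finset.card_le_card (box_mono 3 hk')
    omega
  obtain ⟨b, c, hb, hc, -, hbc, hpb⟩ :=
    (DCT16.pathIn_univ_of_reachable hz).exit (R := (↑(box 3 k) : Set (Site 3)))
      (Finset.mem_coe.2 (zero_mem_box 3 k)) (fun h' => hzk (Finset.mem_coe.1 h'))
  refine ⟨b, ?_, ?_⟩
  · rw [mem_innerBoundary_iff]
    exact ⟨Finset.mem_coe.1 hb, c, fun h' => hc (Finset.mem_coe.2 h'), DCT16.adj_of_openGraph_adj hE hbc⟩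
  · rw [DCT16.mem_openConnIn_iff_pathIn]
    exact hpb.mono Set.inter_subset_left

/-- **The finite-cluster volume tail vanishes qualitatively** (every `p`): for `ε > 0` there is `N` with
`P(|C(0)| < ∞ ∧ R ≤ |C(0)|) ≤ ε` for all `R ≥ N` (continuity of measure from above along `tailSet`, whose
intersection is null). No rate is claimed. -/
theorem finiteTail_eventually_le (p : unitInterval) {ε : ℝ} (hε : 0 < ε) :
    ∃ N : ℕ, ∀ R : ℕ, N ≤ R → (bondPercolation (zdGraph 3) p).real
      {ω | (openCluster ω (0 : Site 3)).Finite ∧ (R : ℝ) ≤ ((openCluster ω (0 : Site 3)).ncard : ℝ)} ≤ ε := by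
  set μ := bondPercolation (zdGraph 3) p with hμ
  have hnull : μ {ω : BondConfig (Site 3) | ¬ ω ⊆ (zdGraph 3).edgeSet} = 0 :=
    ae_iff.1 (ae_subset_edgeSet (zdGraph 3) p)
  have hlim : Tendsto (μ ∘ tailSet) atTop (𝓝 (μ (⋂ r, tailSet r))) :=
    tendsto_measure_iInter_atTop (fun r => (measurableSet_tailSet r).nullMeasurableSet)
      antitone_tailSet ⟨0, measure_ne_top μ _⟩
  have h0 : μ (⋂ r, tailSet r) = 0 :=
    measure_mono_null iInter_tailSet_subset hnull
  rw [h0] at hlim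
  obtain ⟨r₀, hr₀⟩ := (ENNReal.tendsto_atTop_zero.1 hlim) (ENNReal.ofReal ε) (by simpa using hε)
  refine ⟨(box 3 r₀).card + 1, fun R hR => ?_⟩
  -- inclusion into `tailSet r₀ ∪ null`
  have hsub : {ω : BondConfig (Site 3) | (openCluster ω (0 : Site 3)).Finite ∧
        (R : ℝ) ≤ ((openCluster ω (0 : Site 3)).ncard : ℝ)} ⊆
      tailSet r₀ ∪ {ω : BondConfig (Site 3) | ¬ ω ⊆ (zdGraph 3).edgeSet} := by
    rintro ω ⟨hfin, hcard⟩
    by_cases hE : ω ⊆ (zdGraph 3).edgeSet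
    · refine Or.inl (mem_tailSet_of_card hE hfin ?_)
      have : (R : ℝ) ≤ ((openCluster ω (0 : Site 3)).ncard : ℝ) := hcard
      have h' : R ≤ (openCluster ω (0 : Site 3)).ncard := by exact_mod_cast this
      omega
    · exact Or.inr hE
  calc μ.real {ω | (openCluster ω (0 : Site 3)).Finite ∧ (R : ℝ) ≤ ((openCluster ω (0 : Site 3)).ncard : ℝ)}
      ≤ μ.real (tailSet r₀ ∪ {ω : BondConfig (Site 3) | ¬ ω ⊆ (zdGraph 3).edgeSet}) := measureReal_mono hsub
    _ ≤ μ.real (tailSet r₀) + μ.real {ω : BondConfig (Site 3) | ¬ ω ⊆ (zdGraph 3).edgeSet} :=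
        measureReal_union_le _ _
    _ = μ.real (tailSet r₀) := by rw [(measureReal_eq_zero_iff).2 hnull, add_zero]
    _ ≤ ε := ENNReal.toReal_le_of_le_ofReal hε.le (hr₀ r₀ le_rfl)

/-! ### Arithmetic of the scales -/

/-- Eventually in `n`: the four largeness conditions used in the main proof hold simultaneously. -/
theorem eventually_large (K N : ℕ) (hK : 1 ≤ K) {ρ δ : ℝ} (hρ : 0 < ρ) (hδ : 0 < δ) (C : ℝ) :
    ∃ n : ℕ, 1 ≤ n ∧ N ≤ K * n ∧
      ((K : ℝ) * n) ^ 3 ≤ (ρ * (2 * (n : ℝ) + 1) ^ 3 / 2) ^ 2 ∧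
      max C 0 * ((K : ℝ) * n) ^ ((3 : ℝ) - δ) < ρ / 4 * (2 * (n : ℝ) + 1) ^ 3 := by
  -- n → ∞ through the naturals
  have hnat : Tendsto (fun n : ℕ => (n : ℝ)) atTop atTop := tendsto_natCast_atTop_atTop
  have h1 : ∀ᶠ n : ℕ in atTop, 1 ≤ n := eventually_ge_atTop 1
  have h2 : ∀ᶠ n : ℕ in atTop, N ≤ K * n := by
    filter_upwards [eventually_ge_atTop N] with n hn
    exact hn.trans (Nat.le_mul_of_pos_left n hK)
  -- (c): K³ n³ ≤ 16 ρ² n⁶ ⟸ K³ ≤ 16 ρ² n³, eventually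
  have h3 : ∀ᶠ n : ℕ in atTop, ((K : ℝ) * n) ^ 3 ≤ (ρ * (2 * (n : ℝ) + 1) ^ 3 / 2) ^ 2 := by
    have hev : ∀ᶠ n : ℕ in atTop, (K : ℝ) ^ 3 / (16 * ρ ^ 2) ≤ (n : ℝ) ^ 3 := by
      have : Tendsto (fun n : ℕ => (n : ℝ) ^ 3) atTop atTop := (tendsto_pow_atTop (by norm_num)).comp hnat
      exact this.eventually_ge_atTop _
    filter_upwards [hev] with n hn
    have hn0 : (0 : ℝ) ≤ n := Nat.cast_nonneg n
    have hρ2 : 0 < 16 * ρ ^ 2 := by positivity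
    have hK3 : (K : ℝ) ^ 3 ≤ 16 * ρ ^ 2 * (n : ℝ) ^ 3 := by
      rw [div_le_iff₀ hρ2] at hn; linarith
    have h8 : 8 * (n : ℝ) ^ 3 ≤ (2 * (n : ℝ) + 1) ^ 3 := by nlinarith
    calc ((K : ℝ) * n) ^ 3 = (K : ℝ) ^ 3 * (n : ℝ) ^ 3 := by ring
      _ ≤ (16 * ρ ^ 2 * (n : ℝ) ^ 3) * (n : ℝ) ^ 3 := by gcongr
      _ = (ρ * (8 * (n : ℝ) ^ 3) / 2) ^ 2 := by ring
      _ ≤ (ρ * (2 * (n : ℝ) + 1) ^ 3 / 2) ^ 2 := by gcongr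
  -- (d): max C 0 · K^{3-δ} n^{3-δ} < 2 ρ n³ ≤ (ρ/4)(2n+1)³, eventually (n^δ → ∞)
  have h4 : ∀ᶠ n : ℕ in atTop,
      max C 0 * ((K : ℝ) * n) ^ ((3 : ℝ) - δ) < ρ / 4 * (2 * (n : ℝ) + 1) ^ 3 := by
    have hKpos : (0 : ℝ) < K := by exact_mod_cast hK
    set A : ℝ := max C 0 * (K : ℝ) ^ ((3 : ℝ) - δ) with hA
    have hA0 : 0 ≤ A := mul_nonneg (le_max_right _ _) (Real.rpow_nonneg hKpos.le _)
    have hev : ∀ᶠ n : ℕ in atTop, A / ρ + 1 ≤ (n : ℝ) ^ δ := by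
      have : Tendsto (fun n : ℕ => (n : ℝ) ^ δ) atTop atTop := (tendsto_rpow_atTop hδ).comp hnat
      exact this.eventually_ge_atTop _
    filter_upwards [hev, eventually_ge_atTop 1] with n hn hn1
    have hn0 : (0 : ℝ) < n := by exact_mod_cast Nat.lt_of_lt_of_le Nat.zero_lt_one hn1
    have hsplit : ((K : ℝ) * n) ^ ((3 : ℝ) - δ) = (K : ℝ) ^ ((3 : ℝ) - δ) * ((n : ℝ) ^ ((3 : ℝ) - δ)) :=
      Real.mul_rpow hKpos.le hn0.le
    have hn3 : (n : ℝ) ^ (3 : ℝ) = (n : ℝ) ^ ((3 : ℝ) - δ) * (n : ℝ) ^ δ := by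
      rw [← Real.rpow_add hn0]; ring_nf
    have hn3' : (n : ℝ) ^ (3 : ℝ) = (n : ℝ) ^ (3 : ℕ) := by exact_mod_cast Real.rpow_natCast (n : ℝ) 3
    have hnd : 0 < (n : ℝ) ^ ((3 : ℝ) - δ) := Real.rpow_pos_of_pos hn0 _
    -- A n^{3-δ} < ρ n^{3-δ} n^δ = ρ n³
    have hlt : A * (n : ℝ) ^ ((3 : ℝ) - δ) < ρ * (n : ℝ) ^ (3 : ℕ) := by
      have hAρ : A < ρ * (n : ℝ) ^ δ := by
        have : A / ρ < (n : ℝ) ^ δ := by linarith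
        rwa [div_lt_iff₀ hρ, mul_comm] at this
      calc A * (n : ℝ) ^ ((3 : ℝ) - δ) < ρ * (n : ℝ) ^ δ * (n : ℝ) ^ ((3 : ℝ) - δ) :=
            mul_lt_mul_of_pos_right hAρ hnd
        _ = ρ * (n : ℝ) ^ (3 : ℕ) := by rw [← hn3', hn3]; ring
    have h8 : 8 * (n : ℝ) ^ 3 ≤ (2 * (n : ℝ) + 1) ^ 3 := by nlinarith
    calc max C 0 * ((K : ℝ) * n) ^ ((3 : ℝ) - δ) = A * (n : ℝ) ^ ((3 : ℝ) - δ) := by rw [hsplit, hA]; ring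
      _ < ρ * (n : ℝ) ^ (3 : ℕ) := hlt
      _ ≤ ρ / 4 * (8 * (n : ℝ) ^ 3) := by
          have : 0 ≤ ρ * (n : ℝ) ^ (3 : ℕ) := by positivity
          linarith
      _ ≤ ρ / 4 * (2 * (n : ℝ) + 1) ^ 3 := by gcongr
  obtain ⟨n, hn⟩ := (h1.and (h2.and (h3.and h4))).exists
  exact ⟨n, hn.1, hn.2.1, hn.2.2.1, hn.2.2.2⟩

end GiantLRO

open GiantLRO

/-- **0855 ∧ B_∞ ⟹ θ(p_c) = 0**: linear-scale box long-range order for percolating `p`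
(`PercFiniteBoxLRO.LinearScaleLROOfTheta`, stmt-CriticalPhenomena-0855) and the registered stub B_∞
(`stub_giantFatMass`, verbatim) already give `PercolationContinuityZ3`.  Since conversely `θ(p_c) = 0 ⟹ B_∞`
(`giantFatMass_of_continuity`), B_∞ is summit-EQUIVALENT modulo 0855. -/
theorem percolationContinuityZ3_of_linearScaleLRO_of_giantFatMass :
    Summit.CriticalPhenomena.PercolationContinuityZ3.Theses.PercFiniteBoxLRO.LinearScaleLROOfTheta →
    (∃ δ C : ℝ, 0 < δ ∧ ∀ R : ℕ, 1 ≤ R →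
      ∑ x ∈ box 3 R, (bondPercolation (zdGraph 3) (criticalProbI 3)).real
        {ω | (∃ T : Finset (Site 3), Nat.sqrt (R ^ 3) ≤ T.card ∧
            ∀ y ∈ T, ω ∈ openConnIn (↑(box 3 R) : Set (Site 3)) x y) ∧
          (openCluster ω x).Infinite}
        ≤ C * (R : ℝ) ^ ((3 : ℝ) - δ)) →
      _root_.PercolationContinuityZ3 := by
  intro hX hB
  by_contra hcon
  have hθ : 0 < theta (zdGraph 3) (0 : Site 3) (criticalProbI 3) := by
    have h0 : 0 ≤ theta (zdGraph 3) (0 : Site 3) (criticalProbI 3) := measureReal_nonneg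
    exact lt_of_le_of_ne h0 (fun h => hcon h.symm)
  set μ := bondPercolation (zdGraph 3) (criticalProbI 3) with hμ
  obtain ⟨ρ, hρ, K, hLRO⟩ := hX (criticalProbI 3) hθ
  obtain ⟨δ, CB, hδ, hB⟩ := hB
  -- `K ≥ 1` (for `K = 0` the LRO event at `x = e₀ ∈ Λ_1 \ Λ_0` is empty)
  have hK : 1 ≤ K := by
    by_contra hK0
    have hK0' : K = 0 := by omega
    set e : Site 3 := Pi.single 0 1 with he
    have he1 : e ∈ box 3 1 := by
      rw [mem_box]; intro i
      by_cases hi : i = 0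
      · subst hi; simp [he]
      · simp [he, hi]
    have he0 : e ∉ box 3 (K * 1) := by
      rw [hK0', mem_box, not_forall]
      exact ⟨0, by simp [he]⟩
    have h := hLRO 1 le_rfl e he1 e he1
    have hempty : (openConnIn (↑(box 3 (K * 1)) : Set (Site 3)) e e : Set (BondConfig (Site 3))) = ∅ := by
      ext ω
      simp only [Set.mem_empty_iff_false, iff_false]
      rintro ⟨hx, -, -⟩
      exact he0 (Finset.mem_coe.1 hx)
    rw [hempty, measureReal_empty] at h
    linarith
  -- the finite tail below `ρ/4`
  obtain ⟨N, hN⟩ := finiteTail_eventually_le (criticalProbI 3) (by linarith : 0 < ρ / 4)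
  -- the scale
  obtain ⟨n, hn1, hNn, hc3, hc4⟩ := eventually_large K N hK hρ hδ CB
  set R : ℕ := K * n with hR
  have hR1 : 1 ≤ R := le_trans hK (Nat.le_mul_of_pos_right K hn1)
  have hnR : n ≤ R := Nat.le_mul_of_pos_left n hK
  have hρR : (0 : ℝ) < R := by exact_mod_cast hR1
  have hcard : ((box 3 n).card : ℝ) = (2 * (n : ℝ) + 1) ^ 3 := by rw [card_box]; push_cast; ring
  have hcard0 : (0 : ℝ) < ((box 3 n).card : ℝ) := by rw [hcard]; positivity
  set t : ℝ := ρ * ((box 3 n).card : ℝ) / 2 with ht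
  have ht0 : 0 ≤ t := by positivity
  -- `⌊R^{3/2}⌋ ≤ t`
  have hsqrt : ((Nat.sqrt (R ^ 3) : ℕ) : ℝ) ≤ t := by
    have h1 : ((Nat.sqrt (R ^ 3) : ℕ) : ℝ) ^ 2 ≤ ((R ^ 3 : ℕ) : ℝ) := by
      exact_mod_cast Nat.sqrt_le' (R ^ 3)
    have hRK : ((R ^ 3 : ℕ) : ℝ) = ((K : ℝ) * n) ^ 3 := by rw [hR]; push_cast; ring
    have h2 : ((R ^ 3 : ℕ) : ℝ) ≤ t ^ 2 := by rw [hRK, ht, hcard]; exact hc3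
    exact le_of_pow_le_pow_left₀ two_ne_zero ht0 (h1.trans h2)
  have hR2 : R ^ 2 ≤ R ^ 3 := Nat.pow_le_pow_right hR1 (by norm_num)
  have hRn : R ≤ Nat.sqrt (R ^ 3) := Nat.le_sqrt.2 (by simpa [sq] using hR2)
  -- per-vertex lower bound on the fat-giant probability
  have hfatinf : ∀ x ∈ box 3 n, ρ / 4 ≤ μ.real
      {ω | (∃ T : Finset (Site 3), Nat.sqrt (R ^ 3) ≤ T.card ∧
          ∀ y ∈ T, ω ∈ openConnIn (↑(box 3 R) : Set (Site 3)) x y) ∧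
        (openCluster ω x).Infinite} := by
    intro x hx
    -- LRO, summed over `y ∈ Λ_n`
    have hsum : ρ * ((box 3 n).card : ℝ) ≤
        ∑ y ∈ box 3 n, μ.real (openConnIn (↑(box 3 R) : Set (Site 3)) x y) := by
      have h := Finset.sum_le_sum fun y hy => hLRO n hn1 x hx y hy
      rw [Finset.sum_const, nsmul_eq_mul, mul_comm] at h
      exact h
    -- reverse Markov, so `P(G_x) ≥ ρ/2`
    have hrm := sum_real_le (criticalProbI 3) n R x ht0
    have hG : ρ / 2 ≤ μ.real
        {ω | t ≤ (((box 3 n).filter fun y => ω ∈ openConnIn (↑(box 3 R) : Set (Site 3)) x y).card : ℝ)} := by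
      have h' : ((box 3 n).card : ℝ) * (ρ / 2) ≤ ((box 3 n).card : ℝ) * μ.real
          {ω | t ≤ (((box 3 n).filter fun y =>
            ω ∈ openConnIn (↑(box 3 R) : Set (Site 3)) x y).card : ℝ)} := by
        have := hsum.trans hrm
        rw [ht] at this
        linarith
      exact le_of_mul_le_mul_left h' hcard0
    -- `G_x ⊆ fat_R(x)`, and the jump split
    have hGfat : μ.real
        {ω | t ≤ (((box 3 n).filter fun y => ω ∈ openConnIn (↑(box 3 R) : Set (Site 3)) x y).card : ℝ)} ≤
        μ.real {ω | ∃ T : Finset (Site 3), Nat.sqrt (R ^ 3) ≤ T.card ∧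
          ∀ y ∈ T, ω ∈ openConnIn (↑(box 3 R) : Set (Site 3)) x y} :=
      measureReal_mono fun ω hω => fat_of_count hsqrt hω
    have hsplit := JumpSplit.measureReal_fat_le_giant_add_finiteTail (criticalProbI 3) hRn x
    have htail := hN R hNn
    linarith
  -- sum over `x ∈ Λ_n ⊆ Λ_R` and compare with B_∞
  have hlow : ρ / 4 * ((box 3 n).card : ℝ) ≤ ∑ x ∈ box 3 R, μ.real
      {ω | (∃ T : Finset (Site 3), Nat.sqrt (R ^ 3) ≤ T.card ∧
          ∀ y ∈ T, ω ∈ openConnIn (↑(box 3 R) : Set (Site 3)) x y) ∧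
        (openCluster ω x).Infinite} :=
    calc ρ / 4 * ((box 3 n).card : ℝ) = ∑ x ∈ box 3 n, ρ / 4 := by
          rw [Finset.sum_const, nsmul_eq_mul, mul_comm]
      _ ≤ ∑ x ∈ box 3 n, μ.real
          {ω | (∃ T : Finset (Site 3), Nat.sqrt (R ^ 3) ≤ T.card ∧
              ∀ y ∈ T, ω ∈ openConnIn (↑(box 3 R) : Set (Site 3)) x y) ∧
            (openCluster ω x).Infinite} := Finset.sum_le_sum hfatinf
      _ ≤ _ := Finset.sum_le_sum_of_subset_of_nonneg (box_mono 3 hnR) fun _ _ _ => measureReal_nonneg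
  have hup : ∑ x ∈ box 3 R, μ.real
      {ω | (∃ T : Finset (Site 3), Nat.sqrt (R ^ 3) ≤ T.card ∧
          ∀ y ∈ T, ω ∈ openConnIn (↑(box 3 R) : Set (Site 3)) x y) ∧
        (openCluster ω x).Infinite} ≤ max CB 0 * (R : ℝ) ^ ((3 : ℝ) - δ) :=
    (hB R hR1).trans (mul_le_mul_of_nonneg_right (le_max_left _ _) (Real.rpow_nonneg hρR.le _))
  have hRK : (R : ℝ) = (K : ℝ) * n := by rw [hR]; push_cast; ring
  rw [hRK] at hup
  rw [hcard] at hlow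
  linarith

end Summit.CriticalPhenomena.PercolationContinuityZ3.FreeBoxFatClusterMassLine

end
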